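import Summits.Ventures.Crystal3D.Bulk.LocalTwelve
import Summits.Ventures.Crystal3D.LocalLP.ClassicalInputsDischarged
import HarnessLib

/-!
# The exponent `2/3` in `BulkCrystallization3D` is optimal

Venture `Crystal3D` (cell `pub-crystal3d`, seat theory-2 (g8), 2026-08-23). The cell's phase-2 target
`BulkCrystallization3D K` (`Bulk/LocalTwelve.lean`) bounds the number of balls of a sticky ground state whose
contact shell is NOT close-packed by `K · N^{2/3}` from ABOVE. This file records the matching bound from
BELOW, which holds for EVERY packing (ground state or not) and is already implicit in the tree:

* `sum_twelve_sub_coordination_le_card_coordination_lt_twelve` — the total coordination deficit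
  `∑ᵢ (12 − deg i)` is at most `12 · #{i : deg i < 12}` (any configuration);
* `coordination_lt_twelve_subset_nonClosePacked` — an under-coordinated ball of a packing is not close-packed
  (`IsClosePackedShell.coordination_eq`);
* **`card_coordination_lt_twelve_gt` / `card_nonClosePacked_gt`** — every packing of `N ≥ 2` unit balls in
  `ℝ³` has MORE than `(167/600) · N^{2/3} ≈ 0.278 · N^{2/3}` balls with fewer than twelve contacts, hence
  more than that many balls whose contact shell is not close-packed: handshake
  `∑ᵢ (12 − deg i) + 2 C(x) = 12 N` (`sum_twelve_sub_coordination_add`) and the tree's UNCONDITIONAL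
  surface bound `C(x) < 6N − 1.67 N^{2/3}` (`numContacts_lt_levy`, the Lévy rung of the cell's phase-1
  ladder, std axioms: Lévy–Schmidt spherical isoperimetry + Federer's isoperimetric inequality for unions
  of balls, both tree theorems);
* **`not_bulkCrystallization3D_of_lt`** — consequently `BulkCrystallization3D K` is FALSE for every
  `K < 167/600`; together with the cell's conditional `BulkCrystallization3D 702` this pins the order
  `N^{2/3}` of the defect count: the exponent `2/3` cannot be lowered, only the constant is at stake
  (`IsStickyGroundState.card_nonClosePacked_two_sided`).

HONEST FRAMING: no crystallization statement is proved here; the upper bound `BulkCrystallization3D 702`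
stays CONDITIONAL on GAP(1.26) exactly as recorded in `Bulk/BulkOfGapComputational.lean`. This file is the
"sharpness of the exponent" remark for the paper's theorem box, with every step a tree theorem (std axioms).
-/

noncomputable section

open scoped BigOperators
open Finset

namespace Summit.Ventures.Crystal3D

variable {N : ℕ} {x : Fin N → EuclideanSpace ℝ (Fin 3)}

/-- The total coordination deficit is carried by the under-coordinated balls:
`∑ᵢ (12 − deg i) ≤ 12 · #{i : deg i < 12}` (truncated subtraction: a ball with `deg ≥ 12` contributes
`0`, any ball at most `12`). Holds for every configuration. -/
theorem sum_twelve_sub_coordination_le_card_coordination_lt_twelve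
    (x : Fin N → EuclideanSpace ℝ (Fin 3)) :
    ∑ i, (12 - coordination x i) ≤ 12 * (univ.filter fun i => coordination x i < 12).card := by
  classical
  have hvan : ∀ i ∈ (univ : Finset (Fin N)), i ∉ (univ.filter fun i => coordination x i < 12) →
      12 - coordination x i = 0 := by
    intro i _ hi
    have h : ¬ coordination x i < 12 := fun h => hi (mem_filter.2 ⟨mem_univ _, h⟩)
    omega
  rw [← sum_subset (filter_subset _ _) hvan]
  calc ∑ i ∈ univ.filter (fun i => coordination x i < 12), (12 - coordination x i)
      ≤ ∑ _i ∈ univ.filter (fun i => coordination x i < 12), 12 :=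
        sum_le_sum fun i _ => Nat.sub_le _ _
    _ = 12 * (univ.filter fun i => coordination x i < 12).card := by
        rw [sum_const, smul_eq_mul, mul_comm]

/-- In a packing, an under-coordinated ball is not close-packed (a close-packed shell has exactly twelve
points, `IsClosePackedShell.coordination_eq`). -/
theorem coordination_lt_twelve_subset_nonClosePacked (hx : IsUnitPacking x) :
    (univ.filter fun i => coordination x i < 12) ⊆ nonClosePacked x := by
  classical
  intro i hi
  refine mem_nonClosePacked.2 fun hc => ?_
  have h := (mem_filter.1 hi).2
  rw [hc.coordination_eq hx] at h
  exact lt_irrefl _ h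

/-- **Every packing has `> 0.278 · N^{2/3}` under-coordinated balls.** For a packing `x` of `N ≥ 2`
unit-diameter balls in `ℝ³`, `(167/600) · N^{2/3} < #{i : deg i < 12}`: the handshake
`∑ᵢ (12 − deg i) + 2 C(x) = 12N` and the unconditional surface bound `C(x) < 6N − 1.67 N^{2/3}`
(`numContacts_lt_levy`) give `∑ᵢ (12 − deg i) > 3.34 N^{2/3}`, and each deficit term is `≤ 12`. -/
theorem card_coordination_lt_twelve_gt (hN : 2 ≤ N) (hx : IsUnitPacking x) :
    (167 / 600 : ℝ) * (N : ℝ) ^ ((2 : ℝ) / 3) <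
      ((univ.filter fun i => coordination x i < 12).card : ℝ) := by
  have h1 : ((∑ i, (12 - coordination x i) : ℕ) : ℝ) + 2 * (numContacts x : ℝ) = 12 * N := by
    exact_mod_cast sum_twelve_sub_coordination_add hx
  have h2 : ((∑ i, (12 - coordination x i) : ℕ) : ℝ) ≤
      12 * ((univ.filter fun i => coordination x i < 12).card : ℝ) := by
    exact_mod_cast sum_twelve_sub_coordination_le_card_coordination_lt_twelve x
  have h3 := numContacts_lt_levy hN x hx
  linarith

/-- **Every packing has `> 0.278 · N^{2/3}` non-close-packed balls**: for a packing of `N ≥ 2`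
unit-diameter balls in `ℝ³`, `(167/600) · N^{2/3} < #nonClosePacked x`. This is the lower bound matching
`BulkCrystallization3D K` (`#nonClosePacked x ≤ K · N^{2/3}` in ground states): the exponent `2/3` is optimal. -/
theorem card_nonClosePacked_gt (hN : 2 ≤ N) (hx : IsUnitPacking x) :
    (167 / 600 : ℝ) * (N : ℝ) ^ ((2 : ℝ) / 3) < ((nonClosePacked x).card : ℝ) := by
  classical
  have h := card_le_card (coordination_lt_twelve_subset_nonClosePacked hx)
  exact lt_of_lt_of_le (card_coordination_lt_twelve_gt hN hx) (by exact_mod_cast h)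

/-- In particular in every sticky ground state of `N ≥ 2` balls. -/
theorem IsStickyGroundState.card_nonClosePacked_gt (hN : 2 ≤ N) (hx : IsStickyGroundState x) :
    (167 / 600 : ℝ) * (N : ℝ) ^ ((2 : ℝ) / 3) < ((nonClosePacked x).card : ℝ) :=
  Crystal3D.card_nonClosePacked_gt hN hx.1

/-- **`BulkCrystallization3D K` is false for every `K < 167/600`.** (Sticky ground states exist for every
`N`, `exists_numContacts_eq_maxContacts`; at `N = 2` the lower bound already exceeds `K · 2^{2/3}`.) So in
the cell's target the power `N^{2/3}` cannot be replaced by any `o(N^{2/3})`, and the best constant lies in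
`[167/600, 702]` (the upper end conditional on GAP(1.26)). -/
theorem not_bulkCrystallization3D_of_lt {K : ℝ} (hK : K < 167 / 600) : ¬ BulkCrystallization3D K := by
  intro h
  obtain ⟨x, hx, hxe⟩ := exists_numContacts_eq_maxContacts (d := 3) (N := 2) (by norm_num)
  have hgs : IsStickyGroundState x := by
    unfold IsStickyGroundState
    exact ⟨hx, hxe⟩
  have h1 := h 2 x hgs
  have h2 := card_nonClosePacked_gt (le_refl 2) hx
  have h3 : (0 : ℝ) < ((2 : ℕ) : ℝ) ^ ((2 : ℝ) / 3) := by positivity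
  nlinarith [mul_pos (sub_pos.2 hK) h3]

/-- **Two-sided form** (for the paper's theorem box): under `BulkCrystallization3D K`, every sticky ground
state of `N ≥ 2` unit balls in `ℝ³` has its number of non-close-packed balls pinned between
`(167/600) · N^{2/3}` and `K · N^{2/3}`; the lower bound is unconditional and holds for every packing. -/
theorem IsStickyGroundState.card_nonClosePacked_two_sided {K : ℝ} (hB : BulkCrystallization3D K)
    (hN : 2 ≤ N) (hx : IsStickyGroundState x) :
    (167 / 600 : ℝ) * (N : ℝ) ^ ((2 : ℝ) / 3) < ((nonClosePacked x).card : ℝ) ∧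
      ((nonClosePacked x).card : ℝ) ≤ K * (N : ℝ) ^ ((2 : ℝ) / 3) :=
  ⟨hx.card_nonClosePacked_gt hN, hB N x hx⟩

/-- Hence any valid constant of the bulk theorem is at least `167/600`. -/
theorem le_of_bulkCrystallization3D {K : ℝ} (hB : BulkCrystallization3D K) : (167 / 600 : ℝ) ≤ K :=
  not_lt.1 fun hK => not_bulkCrystallization3D_of_lt hK hB

end Summit.Ventures.Crystal3D

end
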